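import Literature.NumberTheory.EllipticCurves.PeriodIndexCorestrictionLocal
import Literature.NumberTheory.EllipticCurves.PeriodIndexKummerPhi
import HarnessLib

/-!
# Local triviality of the corestricted Kummer classes `cores Φ(a, b)` (Clark–Sharif §3.6)

`Proofs`-style file (theorems only; no definitions, no named facts) under the provefact seat on
`Literature.NumberTheory.EllipticCurves.ClarkSharif2010_thm2` (Clark–Sharif 2010, Theorem 2).
It assembles the tree's corestriction machinery (`PeriodIndexCorestriction`: `coresH1`;
`PeriodIndexCorestrictionLocal`: the double coset formula `resH1Hom_coresH1_eq_sum` and its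
vanishing form `resH1Hom_coresH1_eq_zero`) with the classes `Φ(a, b) ∈ H¹(𝔤_k, M)` of
`PeriodIndexKummerPhi` into the formal version of the last paragraph of §3.6:

> "Let `η_i` be the image of `ξ_i` in `H¹(K, E)`. It remains to show that `res_v η_i = 0` for
> `v ∈ S_K`. Recall that `η_i = cores Φ(π_i, 1)` or `cores Φ(π_i, π_i')`. For `w ∣ v` a place of
> `K_P`, the proof of Theorem 1 showed that the curves corresponding to `Φ(π_i, 1)` and
> `Φ(π_i, π_i')` were trivial at `w`. But the corestriction map induces a homomorphism
> `⊕_{w ∣ v} H¹((K_P)_w, E) → H¹(K_v, E)` which proves that `η_i` is trivial at `v`."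

together with the "bad prime" half of the local analysis of Theorem 1 (§3.2: "First let `w` be
a bad prime. Then, by construction, `π' ∈ K_w^{×P}` so `ξ|_{K_w} = 0`; a fortiori `η_w = 0`"),
which is how the finitely many places `v ∈ S_K` are disposed of (they are put among the primes
of the modulus of (SC3'), Lemma 14).  In the subgroup model `𝔤_k = N ≤ G = 𝔤_K` and for a local
group `φ : D → G` (in the application `φ = resGal K_v : Γ_{K_v} → Γ_K`, and the places `w ∣ v`
of `k` correspond to the double cosets `N g φ(D)`), "`a ∈ k_w^{×P}` for every `w ∣ v`" is the
Galois-theoretic condition that the Kummer character `f_a` of `a` vanishes on every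
`N ∩ g⁻¹ φ(D) g`, i.e. `f_a(g⁻¹ φ(d) g) = 0` whenever `g⁻¹ φ(d) g ∈ N`; under this hypothesis
for `a` and `b`:

* `resH1Hom_coresH1_oneCocycleClass_eq_zero` — generic form: for an open normal finite-index
  `N ≤ G` and a continuous cocycle `f` of `N` with `f(g⁻¹ φ(d) g) = 0` whenever
  `g⁻¹ φ(d) g ∈ N`, the class `cores_N^G [f]` restricts to `0` along any compatible pair
  `(φ, ψ)` (each term of the double coset formula is the transfer of a cocycle that vanishes
  identically);
* `resH1Hom_coresH1_kummerPhi_eq_zero` — `res_{(φ, ψ)} (cores Φ(a, b)) = 0`;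
* `resH1Hom_map_coresH1_kummerPhi_eq_zero` — the same for `α_* (cores Φ(a, b))`, `α : M → M₂`
  an equivariant change of coefficients;
* `map_coresH1_kummerPhi_mem_localRestrictionKer`, `coresH1_map_kummerPhi_mem_localRestrictionKer`
  — for a Weierstrass curve `E = W` over `K`, a `K`-field `K'` (a completion `K_v`, finite or
  infinite), and a `G`-equivariant `α : M → E(K̄)` (the inclusion of `E[P]`), the image of
  `cores Φ(a, b)` in `H¹(K, E) = W.galH1` lies in `W.localRestrictionKer K'` — the
  local-triviality clause of `ClarkSharif2010_thm2` for the classes `η_i`, in the form consumed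
  by `ClarkSharif2010_thm2_of_primePow_torsion_index` (`PeriodIndexProofs`);
* `nsmul_eq_zero_of_forall_nsmul_eq_zero`, `nsmul_kummerPhi_eq_zero`,
  `nsmul_map_coresH1_kummerPhi_eq_zero` — the classes `Φ(a, b)` and `η = α_* cores Φ(a, b)` are
  killed by `P` when `P` kills `M` (`M = E[P]`): Clark–Sharif §3.6, "Clearly, `P(C) ∣ P`" — the
  torsion input `p^n • ξ_i = 0` of `ClarkSharif2010_thm2_of_primePow_torsion_index`;
* `closureEmb_resGal_smul`, `unitChar_eq_zero_of_exists_pow_eq`,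
  `map_coresH1_kummerPhi_mem_localRestrictionKer_of_exists_pow_eq` — the Galois-form local
  hypothesis from the FIELD-THEORETIC one of the source: with `ι = closureEmb K' : K̄ → K̄'` the
  chosen embedding and `k_g = K'(ι(g k)) ⊆ K̄'` the composite field (the completion of `k` at the
  place above `K'` determined by `g`), if `ι(g a)` is a `P`-th power in `k_g`
  ("`a ∈ k_w^{×P}`", (SC3')) then `f_a(g⁻¹ σ|_{K̄} g) = 0` for every `σ ∈ Γ_{K'}` with
  `g⁻¹ σ|_{K̄} g ∈ 𝔤_k`; hence `η = α_* cores Φ(a, b)` is locally trivial at `K'` as soon as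
  `a` and `b` are `P`-th powers in every `k_g`.

## References

* P. L. Clark, S. Sharif, *Period, index and potential Ш*, Algebra & Number Theory 4 (2010)
  151–174, §3.2 (proof of Theorem 1: bad primes), §3.6 (last paragraph); arXiv:0811.3019 read.
  [ClarkSharif2010]
* J. Neukirch, A. Schmidt, K. Wingberg, *Cohomology of Number Fields*, 2nd ed. (2008), I.§5
  (double coset formula). [NeukirchSchmidtWingberg2008]
-/

noncomputable section

open scoped Classical

universe u

namespace Literature.NumberTheory.EllipticCurves

open GaloisRepresentations Field

/-! ## Generic vanishing: cocycles vanishing on all `N ∩ g⁻¹ φ(D) g` -/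

section Generic

variable {G : Type u} [Group G] [TopologicalSpace G] [IsTopologicalGroup G]
variable {D : Type u} [Group D] [TopologicalSpace D] [IsTopologicalGroup D]
variable (N : Subgroup G) [N.Normal] [Fintype (G ⧸ N)]
variable {M : Type u} [AddCommGroup M] [DistribMulAction G M] [TopologicalSpace M]
  [DiscreteTopology M]
variable {M' : Type u} [AddCommGroup M'] [DistribMulAction D M'] [TopologicalSpace M']
  [DiscreteTopology M']
variable (φ : D →ₜ* G) (ψ : M →+ M')

/-- **Corestricted classes of cocycles vanishing on all `N ∩ g⁻¹φ(D)g` restrict to zero.**  Let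
`N ≤ G` be open, normal, of finite index, `(φ : D → G, ψ : M → M')` a compatible pair, and `f` a
continuous cocycle of `N` with `f(g⁻¹ φ(d) g) = 0` whenever `g⁻¹ φ(d) g ∈ N`.  Then
`res_{(φ,ψ)} (cores_N^G [f]) = 0` in `H¹(D, M')`: in the double coset formula
(`resH1Hom_coresH1_eq_sum`) every term is the transfer from `φ⁻¹(N)` of the pull-back of the
conjugate cocycle `g · f : n ↦ g • f(g⁻¹ n g)`, which vanishes identically on `φ⁻¹(N)`.
(Clark–Sharif §3.6: "the corestriction map induces a homomorphism
`⊕_{w∣v} H¹((K_P)_w, E) → H¹(K_v, E)` which proves that `η_i` is trivial at `v`".)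
[cite: ClarkSharif2010, §3.6 (last paragraph)] [cite: NeukirchSchmidtWingberg2008, I.§5] -/
theorem resH1Hom_coresH1_oneCocycleClass_eq_zero
    (hψ : ∀ (d : D) (m : M), ψ (φ d • m) = d • ψ m) (hN : IsOpen (N : Set G))
    (f : contOneCocycles (discreteTopRep N M))
    (hf : ∀ (g : G) (d : D) (hd : g⁻¹ * φ d * g ∈ N), f.1 ⟨g⁻¹ * φ d * g, hd⟩ = 0) :
    resH1Hom φ ψ hψ (coresH1 N hN (oneCocycleClass (discreteTopRep N M) f)) = 0 := by
  haveI : Fintype (D ⧸ N.comap (φ : D →* G)) :=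
    @Fintype.ofFinite _ (finite_quotientComap N (φ : D →* G))
  refine resH1Hom_coresH1_eq_zero N φ ψ hψ hN _ fun g ↦ ?_
  rw [conjH1_oneCocycleClass, resH1Hom_oneCocycleClass]
  have h0 : contOneCocycles.pullback (comapRestrict N φ)
      (resHomOfEquivariant (comapRestrict N φ) ψ (smul_compat_comapRestrict N φ ψ hψ))
      (conjCocycle N g f) = 0 := by
    apply Subtype.ext
    ext e
    rw [pullback_resHomOfEquivariant_apply, conjCocycle_apply]
    have he : f.1 (subgroupConj N g (comapRestrict N φ e)) = 0 :=
      hf g e (subgroupConj N g (comapRestrict N φ e)).2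
    rw [he, smul_zero, map_zero]
    rfl
  rw [h0, ← classHom_apply, map_zero]

end Generic

/-! ## The corestricted Kummer classes `cores Φ(a, b)` -/

section KummerPhi

variable {K : Type u} [Field K] {k : IntermediateField K (AlgebraicClosure K)} {P : ℕ} [NeZero P]
  {ζ : AlgebraicClosure K}
variable [(fixingGal k).Normal] [Fintype (absoluteGaloisGroup K ⧸ fixingGal k)]
variable {M : Type u} [AddCommGroup M] [DistribMulAction (absoluteGaloisGroup K) M]
  [TopologicalSpace M] [DiscreteTopology M]
variable {D : Type u} [Group D] [TopologicalSpace D] [IsTopologicalGroup D]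
variable {M' : Type u} [AddCommGroup M'] [DistribMulAction D M'] [TopologicalSpace M']
  [DiscreteTopology M']

/-- **`res (cores Φ(a, b)) = 0` along a local group on which `f_a`, `f_b` vanish.**  Let
`K ⊆ k ⊆ K̄` with `𝔤_k = fixingGal k` open, normal and of finite index in `𝔤_K`, `ζ ∈ k` a
primitive `P`-th root of unity, `M` a discrete `𝔤_K`-module on which `𝔤_k` acts trivially,
`ρ : (ℤ/P)² → M`, and `(φ : D → 𝔤_K, ψ : M → M')` a compatible pair (a local Galois group and
the passage to local coefficients).  If the Kummer characters of `a, b ∈ kˣ` vanish at every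
`g⁻¹ φ(d) g ∈ 𝔤_k` ("`a, b ∈ k_w^{×P}` for every place `w` of `k` above the place of `φ`",
Clark–Sharif (SC3')/§3.2: "`π' ∈ K_w^{×P}` so `ξ|_{K_w} = 0`"), then
`res_{(φ,ψ)} (cores_{k/K} Φ(a, b)) = 0`.
[cite: ClarkSharif2010, §3.2 (bad primes) and §3.6 (last paragraph)] -/
theorem resH1Hom_coresH1_kummerPhi_eq_zero (hζ : IsPrimitiveRoot ζ P) (hζk : ζ ∈ k)
    (htriv : ∀ (n : fixingGal k) (m : M), n • m = m) (ρ : ZMod P × ZMod P →+ M) (a b : (↥k)ˣ)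
    (hN : IsOpen (fixingGal k : Set (absoluteGaloisGroup K))) (φ : D →ₜ* absoluteGaloisGroup K)
    (ψ : M →+ M') (hψ : ∀ (d : D) (m : M), ψ (φ d • m) = d • ψ m)
    (hloc : ∀ (g : absoluteGaloisGroup K) (d : D) (hd : g⁻¹ * φ d * g ∈ fixingGal k),
      unitChar P ζ a ⟨g⁻¹ * φ d * g, hd⟩ = 0 ∧ unitChar P ζ b ⟨g⁻¹ * φ d * g, hd⟩ = 0) :
    resH1Hom φ ψ hψ (coresH1 (fixingGal k) hN (kummerPhi hζ hζk htriv ρ a b)) = 0 := by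
  refine resH1Hom_coresH1_oneCocycleClass_eq_zero (fixingGal k) φ ψ hψ hN _ fun g d hd ↦ ?_
  rw [kummerPhiCocycle_apply, (hloc g d hd).1, (hloc g d hd).2, Prod.mk_zero_zero, map_zero]

/-- The same after an equivariant change of coefficients `α : M → M₂` applied to the
corestricted class (`cores` commutes with `α`, `coresH1_resH1Hom_id`): the class
`α_* (cores Φ(a, b)) ∈ H¹(𝔤_K, M₂)` restricts to zero along any compatible pair `(φ, ψ₂)`.
[cite: ClarkSharif2010, §3.6 (last paragraph)] -/
theorem resH1Hom_map_coresH1_kummerPhi_eq_zero (hζ : IsPrimitiveRoot ζ P) (hζk : ζ ∈ k)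
    (htriv : ∀ (n : fixingGal k) (m : M), n • m = m) (ρ : ZMod P × ZMod P →+ M) (a b : (↥k)ˣ)
    (hN : IsOpen (fixingGal k : Set (absoluteGaloisGroup K)))
    {M₂ : Type u} [AddCommGroup M₂] [DistribMulAction (absoluteGaloisGroup K) M₂]
    [TopologicalSpace M₂] [DiscreteTopology M₂] (α : M →+ M₂)
    (hα : ∀ (g : absoluteGaloisGroup K) (m : M), α (g • m) = g • α m)
    (φ : D →ₜ* absoluteGaloisGroup K) (ψ₂ : M₂ →+ M')
    (hψ₂ : ∀ (d : D) (m : M₂), ψ₂ (φ d • m) = d • ψ₂ m)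
    (hloc : ∀ (g : absoluteGaloisGroup K) (d : D) (hd : g⁻¹ * φ d * g ∈ fixingGal k),
      unitChar P ζ a ⟨g⁻¹ * φ d * g, hd⟩ = 0 ∧ unitChar P ζ b ⟨g⁻¹ * φ d * g, hd⟩ = 0) :
    resH1Hom φ ψ₂ hψ₂ (resH1Hom (ContinuousMonoidHom.id (absoluteGaloisGroup K)) α hα
      (coresH1 (fixingGal k) hN (kummerPhi hζ hζk htriv ρ a b))) = 0 := by
  rw [resH1Hom_resH1Hom]
  exact resH1Hom_coresH1_kummerPhi_eq_zero hζ hζk htriv ρ a b hN _ _ _ hloc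

end KummerPhi

/-! ## The classes `η = cores Φ(a, b)` in `H¹(K, E)` are locally trivial -/

section Elliptic

variable {K : Type u} [Field K] {k : IntermediateField K (AlgebraicClosure K)} {P : ℕ} [NeZero P]
  {ζ : AlgebraicClosure K}
variable [(fixingGal k).Normal] [Fintype (absoluteGaloisGroup K ⧸ fixingGal k)]
variable {M : Type u} [AddCommGroup M] [DistribMulAction (absoluteGaloisGroup K) M]
  [TopologicalSpace M] [DiscreteTopology M]

/-- **Local triviality of `η = cores Φ(a, b)` in `H¹(K, E)` (Clark–Sharif §3.6, last
paragraph).**  Let `E = W` be a Weierstrass curve over `K`, `K'` a `K`-field (a completion `K_v`,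
finite or infinite), `K ⊆ k ⊆ K̄` with `𝔤_k` open normal of finite index, `ζ ∈ k` a primitive
`P`-th root of unity, `M` a discrete `𝔤_K`-module with trivial `𝔤_k`-action and
`α : M → E(K̄)` equivariant (in the source `M = E[P] ⊂ E(K_P)`), `ρ : (ℤ/P)² → M`.  If the
Kummer characters of `a, b ∈ kˣ` vanish at every `g⁻¹ σ|_{K̄} g ∈ 𝔤_k`, `σ ∈ Γ_{K'}`
("`a, b ∈ k_w^{×P}` for all `w ∣ v`": (SC3') at the primes of `S_K`), then the image
`η = α_* cores_{k/K} Φ(a, b) ∈ H¹(K, E)` is locally trivial at `K'`: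
`η ∈ W.localRestrictionKer K'`.  This is the local-triviality clause of Theorem 2 for the
classes `η_i = cores Φ(π_i, π_i')`, in the form consumed by
`ClarkSharif2010_thm2_of_primePow_torsion_index`.
[cite: ClarkSharif2010, §3.6 (last paragraph) with §3.2 (bad primes)] -/
theorem map_coresH1_kummerPhi_mem_localRestrictionKer (W : WeierstrassCurve K)
    (K' : Type u) [Field K'] [Algebra K K'] (hζ : IsPrimitiveRoot ζ P) (hζk : ζ ∈ k)
    (htriv : ∀ (n : fixingGal k) (m : M), n • m = m) (ρ : ZMod P × ZMod P →+ M) (a b : (↥k)ˣ)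
    (hN : IsOpen (fixingGal k : Set (absoluteGaloisGroup K)))
    (α : M →+ WeierstrassCurve.geomPoints W)
    (hα : ∀ (g : absoluteGaloisGroup K) (m : M), α (g • m) = g • α m)
    (hloc : ∀ (g : absoluteGaloisGroup K) (σ : absoluteGaloisGroup K')
      (hd : g⁻¹ * resGal (K := K) K' σ * g ∈ fixingGal k),
      unitChar P ζ a ⟨g⁻¹ * resGal (K := K) K' σ * g, hd⟩ = 0 ∧
        unitChar P ζ b ⟨g⁻¹ * resGal (K := K) K' σ * g, hd⟩ = 0) :
    resH1Hom (ContinuousMonoidHom.id (absoluteGaloisGroup K)) α hα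
        (coresH1 (fixingGal k) hN (kummerPhi hζ hζk htriv ρ a b)) ∈
      W.localRestrictionKer K' :=
  resH1Hom_map_coresH1_kummerPhi_eq_zero hζ hζk htriv ρ a b hN α hα (resGal (K := K) K')
    (pointsMap W K') (pointsMap_smul W K') hloc

/-- The same for `η = cores_{k/K} (α_* Φ(a, b))` (change of coefficients before the
corestriction; `coresH1_resH1Hom_id`). [cite: ClarkSharif2010, §3.6 (last paragraph)] -/
theorem coresH1_map_kummerPhi_mem_localRestrictionKer (W : WeierstrassCurve K)
    (K' : Type u) [Field K'] [Algebra K K'] (hζ : IsPrimitiveRoot ζ P) (hζk : ζ ∈ k)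
    (htriv : ∀ (n : fixingGal k) (m : M), n • m = m) (ρ : ZMod P × ZMod P →+ M) (a b : (↥k)ˣ)
    (hN : IsOpen (fixingGal k : Set (absoluteGaloisGroup K)))
    (α : M →+ WeierstrassCurve.geomPoints W)
    (hα : ∀ (g : absoluteGaloisGroup K) (m : M), α (g • m) = g • α m)
    (hloc : ∀ (g : absoluteGaloisGroup K) (σ : absoluteGaloisGroup K')
      (hd : g⁻¹ * resGal (K := K) K' σ * g ∈ fixingGal k),
      unitChar P ζ a ⟨g⁻¹ * resGal (K := K) K' σ * g, hd⟩ = 0 ∧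
        unitChar P ζ b ⟨g⁻¹ * resGal (K := K) K' σ * g, hd⟩ = 0) :
    coresH1 (fixingGal k) hN (resH1Hom (ContinuousMonoidHom.id (fixingGal k)) α
        (smul_compat_subgroup (fixingGal k) α hα) (kummerPhi hζ hζk htriv ρ a b)) ∈
      W.localRestrictionKer K' := by
  rw [coresH1_resH1Hom_id]
  exact map_coresH1_kummerPhi_mem_localRestrictionKer W K' hζ hζk htriv ρ a b hN α hα hloc

end Elliptic

/-! ## The classes are `P`-torsion ("Clearly, `P(C) ∣ P`", §3.6) -/

section Torsion

variable {G : Type u} [Group G] [TopologicalSpace G] [IsTopologicalGroup G]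
variable {M : Type u} [AddCommGroup M] [DistribMulAction G M] [TopologicalSpace M]
  [DiscreteTopology M]

/-- **`H¹(G, M)` is killed by `n` when `M` is** (every class is the class of a cocycle, killed
pointwise; `nsmul_oneCocycleClass_eq_zero`). Serre, *Galois Cohomology*, I.§2.2. [folklore] -/
theorem nsmul_eq_zero_of_forall_nsmul_eq_zero {n : ℕ} (hM : ∀ m : M, n • m = 0)
    (c : discreteH1 G M) : n • c = 0 := by
  obtain ⟨f, rfl⟩ := oneCocycleClass_surjective _ c
  exact nsmul_oneCocycleClass_eq_zero f n fun g ↦ hM _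

variable {K : Type u} [Field K] {k : IntermediateField K (AlgebraicClosure K)} {P : ℕ} [NeZero P]
  {ζ : AlgebraicClosure K}
variable {M₁ : Type u} [AddCommGroup M₁] [DistribMulAction (absoluteGaloisGroup K) M₁]
  [TopologicalSpace M₁] [DiscreteTopology M₁]

/-- **`P • Φ(a, b) = 0`** when `P` kills `M` (in the source `M = E[P]`). Clark–Sharif §3.6:
"Clearly, `P(C) ∣ P`." [cite: ClarkSharif2010, §3.6] -/
theorem nsmul_kummerPhi_eq_zero (hζ : IsPrimitiveRoot ζ P) (hζk : ζ ∈ k)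
    (htriv : ∀ (n : fixingGal k) (m : M₁), n • m = m) (ρ : ZMod P × ZMod P →+ M₁) (a b : (↥k)ˣ)
    (hM : ∀ m : M₁, P • m = 0) : P • kummerPhi hζ hζk htriv ρ a b = 0 :=
  nsmul_eq_zero_of_forall_nsmul_eq_zero hM _

/-- **`P • η = 0` for `η = α_* cores_{k/K} Φ(a, b)`** when `P` kills `M` — the torsion clause
`p^n • ξ_i = 0` of `ClarkSharif2010_thm2_of_primePow_torsion_index` for the classes of
Theorem 2 (`cores` and `α_*` are additive). Clark–Sharif §3.6: "Clearly, `P(C) ∣ P`."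
[cite: ClarkSharif2010, §3.6] -/
theorem nsmul_map_coresH1_kummerPhi_eq_zero [(fixingGal k).Normal]
    [Fintype (absoluteGaloisGroup K ⧸ fixingGal k)] (hζ : IsPrimitiveRoot ζ P) (hζk : ζ ∈ k)
    (htriv : ∀ (n : fixingGal k) (m : M₁), n • m = m) (ρ : ZMod P × ZMod P →+ M₁) (a b : (↥k)ˣ)
    (hN : IsOpen (fixingGal k : Set (absoluteGaloisGroup K)))
    {M₂ : Type u} [AddCommGroup M₂] [DistribMulAction (absoluteGaloisGroup K) M₂]
    [TopologicalSpace M₂] [DiscreteTopology M₂] (α : M₁ →+ M₂)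
    (hα : ∀ (g : absoluteGaloisGroup K) (m : M₁), α (g • m) = g • α m)
    (hM : ∀ m : M₁, P • m = 0) :
    P • resH1Hom (ContinuousMonoidHom.id (absoluteGaloisGroup K)) α hα
      (coresH1 (fixingGal k) hN (kummerPhi hζ hζk htriv ρ a b)) = 0 := by
  rw [← map_nsmul, ← map_nsmul, nsmul_kummerPhi_eq_zero hζ hζk htriv ρ a b hM, map_zero,
    map_zero]

end Torsion

/-! ## From "`a ∈ k_w^{×P}` for all `w ∣ v`" to the Galois-form hypothesis -/

section FieldConditions

variable {K : Type u} [Field K] {k : IntermediateField K (AlgebraicClosure K)} {P : ℕ} [NeZero P]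
  {ζ : AlgebraicClosure K}

/-- The chosen embedding `ι = closureEmb K' : K̄ → K̄'` intertwines `resGal K' : Γ_{K'} → Γ_K`:
`ι (σ|_{K̄} • x) = σ • ι x` (`apply_resGalAuxOfEmb_apply` in `•`-notation).
Serre, *Galois Cohomology*, II.§1.1. [folklore] -/
theorem closureEmb_resGal_smul (K' : Type u) [Field K'] [Algebra K K']
    (σ : absoluteGaloisGroup K') (x : AlgebraicClosure K) :
    closureEmb (K := K) K' (resGal (K := K) K' σ • x) = σ • closureEmb (K := K) K' x :=
  apply_resGalAuxOfEmb_apply (closureEmb (K := K) K') σ x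

/-- **"`a ∈ k_w^{×P}` ⟹ `ξ|_{k_w} = 0`" in Galois form** (Clark–Sharif §3.2: "by construction,
`π' ∈ K_w^{×P}` so `ξ|_{K_w} = 0`"; condition (SC3') of §3.4).  Let `K ⊆ k ⊆ K̄`, `ζ ∈ k` a
primitive `P`-th root of unity, `K'` a `K`-field with the chosen embedding
`ι = closureEmb K' : K̄ → K̄'`, `g ∈ Γ_K`, and `k_g = K'(ι(g k)) ⊆ K̄'` the composite field (for
`K' = K_v` a completion this is the completion `k_w` of `k ≅ g k` at the place `w ∣ v` determined
by `g`).  If `ι(g a)` is a `P`-th power in `k_g`, then the Kummer character `f_a` vanishes at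
`g⁻¹ σ|_{K̄} g` for every `σ ∈ Γ_{K'}` with `g⁻¹ σ|_{K̄} g ∈ 𝔤_k`: such a `σ` fixes `K'` and
`ι(g k)` pointwise, hence the `P`-th root `r ∈ k_g` of `ι(g a)`; and `r = ι(g α₁)` for a `P`-th
root `α₁ ∈ K̄` of `a` (the `P`-th roots of unity of `K̄'` are the `ι(g ζ)^j`), so `g⁻¹ σ|_{K̄} g`
fixes `α₁`. [cite: ClarkSharif2010, §3.2 (proof of Thm. 1: bad primes) and §3.4 (SC3')] -/
theorem unitChar_eq_zero_of_exists_pow_eq (hζ : IsPrimitiveRoot ζ P) (hζk : ζ ∈ k)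
    (K' : Type u) [Field K'] [Algebra K K'] (a : (↥k)ˣ) (g : absoluteGaloisGroup K)
    (σ : absoluteGaloisGroup K') (hd : g⁻¹ * resGal (K := K) K' σ * g ∈ fixingGal k)
    (hpow : ∃ r ∈ IntermediateField.adjoin K'
        ((fun y : AlgebraicClosure K ↦ closureEmb (K := K) K' (g • y)) ''
          (k : Set (AlgebraicClosure K))),
      r ^ P = closureEmb (K := K) K' (g • ((a : k) : AlgebraicClosure K))) :
    unitChar P ζ a ⟨g⁻¹ * resGal (K := K) K' σ * g, hd⟩ = 0 := by
  set ι := closureEmb (K := K) K' with hιdef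
  set τ := resGal (K := K) K' σ with hτdef
  set A : AlgebraicClosure K := ((a : k) : AlgebraicClosure K) with hAdef
  have hA : A ∈ k := units_coe_mem a
  have hA0 : A ≠ 0 := units_coe_ne_zero a
  -- `τ` fixes `g • y` for `y ∈ k`
  have hfix : ∀ y ∈ (k : Set (AlgebraicClosure K)), τ • g • y = g • y := by
    intro y hy
    have h1 : (g⁻¹ * τ * g) • y = y := smul_eq_self_of_mem_fixingGal hd hy
    have h2 := congrArg (g • ·) h1
    simpa only [mul_smul, smul_inv_smul] using h2
  -- `σ` fixes `ι (g • y)` for `y ∈ k`, hence the field these generate over `K'`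
  have hσS : ∀ s ∈ (fun y : AlgebraicClosure K ↦ ι (g • y)) '' (k : Set (AlgebraicClosure K)),
      σ • s = s := by
    rintro _ ⟨y, hy, rfl⟩
    change σ • ι (g • y) = ι (g • y)
    rw [← closureEmb_resGal_smul, ← hτdef, hfix y hy]
  obtain ⟨r, hr, hrP⟩ := hpow
  have hσr : σ • r = r := by
    have hle : IntermediateField.adjoin K'
        ((fun y : AlgebraicClosure K ↦ ι (g • y)) '' (k : Set (AlgebraicClosure K))) ≤
        IntermediateField.fixedField
          (Subgroup.zpowers (absoluteGaloisGroup.toAlgEquiv K' σ)) := by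
      rw [IntermediateField.adjoin_le_iff]
      intro s hs
      rw [SetLike.mem_coe, IntermediateField.mem_fixedField_iff]
      intro f hf
      have hstab : Subgroup.zpowers (absoluteGaloisGroup.toAlgEquiv K' σ) ≤
          MulAction.stabilizer (AlgebraicClosure K' ≃ₐ[K'] AlgebraicClosure K') s := by
        rw [Subgroup.zpowers_le, MulAction.mem_stabilizer_iff]
        exact hσS s hs
      exact hstab hf
    exact (IntermediateField.mem_fixedField_iff _ _).mp (hle hr) _ (Subgroup.mem_zpowers _)
  -- `r / ι(g • α)` is a `P`-th root of unity, a power of the primitive root `ι (g • ζ)`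
  set α := pthRoot P A with hαdef
  have hαP : α ^ P = A := pthRoot_pow P A
  have hια : (ι (g • α)) ^ P = ι (g • A) := by rw [← map_pow, ← smul_pow', hαP]
  have hια0 : ι (g • α) ≠ 0 := by
    rw [map_ne_zero_iff ι ι.injective]
    exact (smul_ne_zero_iff_ne g).mpr (ne_zero_of_pow_eq hαP hA0)
  have hprim : IsPrimitiveRoot (ι (g • ζ)) P :=
    (hζ.map_of_injective (absoluteGaloisGroup.toAlgEquiv K g).injective).map_of_injective
      ι.injective
  have hιA0 : ι (g • A) ≠ 0 := by
    rw [← hια]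
    exact pow_ne_zero _ hια0
  have hu : (r * (ι (g • α))⁻¹) ^ P = 1 := by
    rw [mul_pow, inv_pow, hrP, hια, mul_inv_cancel₀ hιA0]
  obtain ⟨j, -, hj⟩ := hprim.eq_pow_of_pow_eq_one hu
  -- so `r = ι (g • α₁)` for the `P`-th root `α₁ = ζ^j α` of `A`
  have hr' : r = ι (g • (ζ ^ j * α)) := by
    rw [smul_mul', smul_pow', map_mul, map_pow, hj, inv_mul_cancel_right₀ hια0]
  have hα₁ : (ζ ^ j * α) ^ P = A := by
    rw [mul_pow, ← pow_mul, mul_comm j P, pow_mul, hζ.pow_eq_one, one_pow, one_mul, hαP]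
  -- `σ • r = r` says that `τ` fixes `g • α₁`, i.e. `g⁻¹ τ g` fixes `α₁`
  have hfixα : τ • g • (ζ ^ j * α) = g • (ζ ^ j * α) := by
    apply ι.injective
    change ι (τ • g • (ζ ^ j * α)) = ι (g • (ζ ^ j * α))
    rw [hτdef, closureEmb_resGal_smul, ← hr']
    exact hσr
  have hn : (g⁻¹ * τ * g) • (ζ ^ j * α) = ζ ^ j * α := by
    rw [mul_smul, mul_smul, hfixα, inv_smul_smul]
  exact kummerChar_eq_of_smul_eq hζ hζk hA hA0 _ hα₁ (by rw [rootPow_zero, one_mul]; exact hn)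

variable [(fixingGal k).Normal] [Fintype (absoluteGaloisGroup K ⧸ fixingGal k)]
variable {M : Type u} [AddCommGroup M] [DistribMulAction (absoluteGaloisGroup K) M]
  [TopologicalSpace M] [DiscreteTopology M]

/-- **Local triviality of `η = α_* cores Φ(a, b)` from "`a, b ∈ k_w^{×P}` for all `w ∣ v`"**
(Clark–Sharif §3.6 last paragraph with §3.2/(SC3')): in the notation of
`map_coresH1_kummerPhi_mem_localRestrictionKer`, if for every `g ∈ Γ_K` the elements
`ι(g a)`, `ι(g b)` are `P`-th powers in the composite field `k_g = K'(ι(g k)) ⊆ K̄'` — i.e.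
`a` and `b` are `P`-th powers in every completion of `k` above `K'` — then
`η ∈ W.localRestrictionKer K'`.
[cite: ClarkSharif2010, §3.6 (last paragraph) with §3.2 (bad primes) and §3.4 (SC3')] -/
theorem map_coresH1_kummerPhi_mem_localRestrictionKer_of_exists_pow_eq (W : WeierstrassCurve K)
    (K' : Type u) [Field K'] [Algebra K K'] (hζ : IsPrimitiveRoot ζ P) (hζk : ζ ∈ k)
    (htriv : ∀ (n : fixingGal k) (m : M), n • m = m) (ρ : ZMod P × ZMod P →+ M) (a b : (↥k)ˣ)
    (hN : IsOpen (fixingGal k : Set (absoluteGaloisGroup K)))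
    (α : M →+ WeierstrassCurve.geomPoints W)
    (hα : ∀ (g : absoluteGaloisGroup K) (m : M), α (g • m) = g • α m)
    (hloc : ∀ g : absoluteGaloisGroup K,
      (∃ r ∈ IntermediateField.adjoin K'
          ((fun y : AlgebraicClosure K ↦ closureEmb (K := K) K' (g • y)) ''
            (k : Set (AlgebraicClosure K))),
        r ^ P = closureEmb (K := K) K' (g • ((a : k) : AlgebraicClosure K))) ∧
      (∃ r ∈ IntermediateField.adjoin K'
          ((fun y : AlgebraicClosure K ↦ closureEmb (K := K) K' (g • y)) ''
            (k : Set (AlgebraicClosure K))),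
        r ^ P = closureEmb (K := K) K' (g • ((b : k) : AlgebraicClosure K)))) :
    resH1Hom (ContinuousMonoidHom.id (absoluteGaloisGroup K)) α hα
        (coresH1 (fixingGal k) hN (kummerPhi hζ hζk htriv ρ a b)) ∈
      W.localRestrictionKer K' :=
  map_coresH1_kummerPhi_mem_localRestrictionKer W K' hζ hζk htriv ρ a b hN α hα
    fun g σ hd ↦ ⟨unitChar_eq_zero_of_exists_pow_eq hζ hζk K' a g σ hd (hloc g).1,
      unitChar_eq_zero_of_exists_pow_eq hζ hζk K' b g σ hd (hloc g).2⟩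

end FieldConditions

end Literature.NumberTheory.EllipticCurves
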